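import Mathlib.GroupTheory.FiniteAbelian.Duality
import Mathlib.RingTheory.RootsOfUnity.AlgebraicallyClosed
import Mathlib.LinearAlgebra.FiniteDimensional.Lemmas
import Mathlib.NumberTheory.Padics.Complex
import HarnessLib

/-!
# The characters of a finite abelian group with values in a field with enough roots of unity SPAN all
# functions on the group (finite Fourier inversion; e.g. values in `ℂ_p`) — proofs only

Topic `GroupTheory/Abelian` (sibling `AddCharIndependence`: Dedekind–Artin INDEPENDENCE over a domain).
THEOREMS ONLY (no definition, no named fact, no `sorry`, no instance).

For a finite commutative group `G` and a field `𝕜` having enough `n`-th roots of unity, `n = exponent G`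
(Mathlib `HasEnoughRootsOfUnity`; every separably closed field of characteristic prime to `n`, in particular
`ℂ_p` for every `p`), the homomorphisms `χ : G →* 𝕜` are `|G|` in number (Mathlib
`CommGroup.card_monoidHom_of_hasEnoughRootsOfUnity`, values of a hom on a group being units) and linearly
independent as functions `G → 𝕜` (Dedekind–Artin, Mathlib `linearIndependent_monoidHom`); since
`dim_𝕜 (G → 𝕜) = |G|` they form a basis, so they SPAN: every `f : G → 𝕜` is a `𝕜`-combination of characters,
and a linear functional killing every character is zero. Serre, *Linear Representations of Finite Groups*,
§2.4–§3.1 (the characters of an abelian group form a basis of the functions); Washington, *Cyclotomic Fields*,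
Lemma 4.7 / §3 (orthogonality). Mathlib has the `ℂ`-valued additive form (`AddChar.complexBasis`); this file is
the form over a general coefficient field, needed `p`-adically.

* `natCard_monoidHom_eq` — `|G →* 𝕜| = |G|`;
* ★ `span_range_monoidHom_eq_top` — `span_𝕜 {⇑χ : χ : G →* 𝕜} = ⊤` in `G → 𝕜`;
* `exists_sum_smul_monoidHom_eq` — `f = Σ_χ c_χ • χ`;
* `linearMap_eq_zero_of_forall_monoidHom` — a `𝕜`-linear functional on `G → 𝕜` vanishing on all characters is `0`;
* `span_range_monoidHom_padicComplex_eq_top`, `linearMap_padicComplex_eq_zero_of_forall_monoidHom` — `𝕜 = ℂ_p`.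

WHY (cell `bsd-print-cf2`, 2026-08-30, director OPTION 1 / planner (T4)): step (ii) of the `j = 0` uniqueness of
the Katz–de Shalit measure — integrals against the avatars `φ̂₀^m·χ̂` vanish for every finite-order `χ` of a
finite abelian quotient; by this file that forces the integrals of `φ̂₀^m·(g ∘ proj)` to vanish for EVERY
function `g` on the quotient.

References: [SerreLinearRepresentations1977] J.-P. Serre, *Linear Representations of Finite Groups*, §2.4,
§3.1; [Washington1997] L. C. Washington, *Introduction to Cyclotomic Fields*, §3 (Lemma 3.8 ff.), §4;
[Lang2002] S. Lang, *Algebra*, Ch. VI §4 Thm. 4.1 (Artin).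
-/

noncomputable section

open scoped Classical

namespace Literature.GroupTheory.Abelian.CharacterSpan

variable (G 𝕜 : Type*) [CommGroup G] [Finite G] [Field 𝕜]

omit [Finite G] in
/-- Homomorphisms from a group into a field take unit values: `(G →* 𝕜) ≃ (G →* 𝕜ˣ)` (Mathlib
`MonoidHom.toHomUnits`). [cite: SerreLinearRepresentations1977, §3.1] -/
theorem natCard_monoidHom_eq_natCard_monoidHom_units : Nat.card (G →* 𝕜) = Nat.card (G →* 𝕜ˣ) := by
  refine Nat.card_congr
    { toFun := fun χ ↦ χ.toHomUnits
      invFun := fun φ ↦ (Units.coeHom 𝕜).comp φ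
      left_inv := fun χ ↦ by ext g; rfl
      right_inv := fun φ ↦ by ext g; rfl }

variable [HasEnoughRootsOfUnity 𝕜 (Monoid.exponent G)]

/-- **`|G →* 𝕜| = |G|`** when `𝕜` has enough roots of unity of order the exponent of `G` (Mathlib
`CommGroup.card_monoidHom_of_hasEnoughRootsOfUnity` for `G →* 𝕜ˣ`). [cite: SerreLinearRepresentations1977, §3.1]
[cite: Washington1997, §3] -/
theorem natCard_monoidHom_eq : Nat.card (G →* 𝕜) = Nat.card G := by
  rw [natCard_monoidHom_eq_natCard_monoidHom_units, CommGroup.card_monoidHom_of_hasEnoughRootsOfUnity G 𝕜]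

/-- There are only finitely many characters `G →* 𝕜`. [cite: SerreLinearRepresentations1977, §3.1] -/
theorem finite_monoidHom : Finite (G →* 𝕜) := by
  have h : Nat.card (G →* 𝕜) ≠ 0 := by
    rw [natCard_monoidHom_eq G 𝕜]
    exact Nat.card_pos.ne'
  exact Nat.finite_of_card_ne_zero h

/-- ★ **THE CHARACTERS SPAN ALL FUNCTIONS**: `span_𝕜 {⇑χ : χ : G →* 𝕜} = ⊤` in `G → 𝕜` — `|G|` linearly
independent vectors (Dedekind–Artin, Mathlib `linearIndependent_monoidHom`) in a space of dimension `|G|`.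
[cite: SerreLinearRepresentations1977, §2.4 and §3.1] [cite: Lang2002, Ch. VI §4 Thm. 4.1] -/
theorem span_range_monoidHom_eq_top :
    Submodule.span 𝕜 (Set.range fun χ : G →* 𝕜 ↦ (χ : G → 𝕜)) = ⊤ := by
  haveI : Fintype G := Fintype.ofFinite G
  haveI : Finite (G →* 𝕜) := finite_monoidHom G 𝕜
  haveI : Fintype (G →* 𝕜) := Fintype.ofFinite _
  haveI : Nonempty (G →* 𝕜) := ⟨1⟩
  have hli : LinearIndependent 𝕜 (fun χ : G →* 𝕜 ↦ (χ : G → 𝕜)) := linearIndependent_monoidHom G 𝕜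
  have hcard : Fintype.card (G →* 𝕜) = Module.finrank 𝕜 (G → 𝕜) := by
    rw [Module.finrank_fintype_fun_eq_card, Fintype.card_eq_nat_card, natCard_monoidHom_eq G 𝕜,
      Nat.card_eq_fintype_card]
  have hb := (basisOfLinearIndependentOfCardEqFinrank hli hcard).span_eq
  rwa [coe_basisOfLinearIndependentOfCardEqFinrank] at hb

/-- Every function on `G` lies in the span of the characters. [cite: SerreLinearRepresentations1977, §2.4] -/
theorem mem_span_range_monoidHom (f : G → 𝕜) :
    f ∈ Submodule.span 𝕜 (Set.range fun χ : G →* 𝕜 ↦ (χ : G → 𝕜)) := by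
  rw [span_range_monoidHom_eq_top G 𝕜]
  exact Submodule.mem_top

/-- **Finite Fourier expansion**: every `f : G → 𝕜` is a finite `𝕜`-combination of characters,
`f = Σ_χ c_χ • χ` (sum over any `Fintype` structure on `G →* 𝕜`). [cite: SerreLinearRepresentations1977, §2.4]
[cite: Washington1997, §3] -/
theorem exists_sum_smul_monoidHom_eq [Fintype (G →* 𝕜)] (f : G → 𝕜) :
    ∃ c : (G →* 𝕜) → 𝕜, ∑ χ : G →* 𝕜, c χ • (χ : G → 𝕜) = f :=
  (Submodule.mem_span_range_iff_exists_fun 𝕜).mp (mem_span_range_monoidHom G 𝕜 f)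

/-- **A linear functional on `G → 𝕜` vanishing on every character vanishes.** (For a measure / linear form
`Φ`: `Φ(χ) = 0` for all `χ : G →* 𝕜` ⇒ `Φ = 0`.) [cite: SerreLinearRepresentations1977, §2.4] [cite: Washington1997, §3] -/
theorem linearMap_eq_zero_of_forall_monoidHom {V : Type*} [AddCommGroup V] [Module 𝕜 V]
    (Φ : (G → 𝕜) →ₗ[𝕜] V) (h : ∀ χ : G →* 𝕜, Φ (χ : G → 𝕜) = 0) : Φ = 0 := by
  refine LinearMap.ext_on_range (span_range_monoidHom_eq_top G 𝕜) fun χ ↦ ?_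
  rw [h χ, LinearMap.zero_apply]

/-- Pointwise form: such a functional vanishes on every function. [cite: SerreLinearRepresentations1977, §2.4] -/
theorem linearMap_apply_eq_zero_of_forall_monoidHom {V : Type*} [AddCommGroup V] [Module 𝕜 V]
    (Φ : (G → 𝕜) →ₗ[𝕜] V) (h : ∀ χ : G →* 𝕜, Φ (χ : G → 𝕜) = 0) (f : G → 𝕜) : Φ f = 0 := by
  rw [linearMap_eq_zero_of_forall_monoidHom G 𝕜 Φ h, LinearMap.zero_apply]

end CharacterSpan

/-! ### The `p`-adic case: `𝕜 = ℂ_p` has enough roots of unity of every order -/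

namespace CharacterSpan

variable (p : ℕ) [Fact p.Prime] (G : Type*) [CommGroup G] [Finite G]

/-- `ℂ_p` has enough `n`-th roots of unity for every `n ≠ 0` (it is algebraically closed of characteristic `0`;
Mathlib `IsSepClosed.hasEnoughRootsOfUnity`). [cite: Washington1997, §3] -/
theorem hasEnoughRootsOfUnity_padicComplex (n : ℕ) [NeZero n] : HasEnoughRootsOfUnity ℂ_[p] n := by
  haveI : NeZero (n : ℂ_[p]) := ⟨Nat.cast_ne_zero.mpr (NeZero.ne n)⟩
  exact IsSepClosed.hasEnoughRootsOfUnity ℂ_[p] n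

/-- ★ **The `ℂ_p`-valued characters of a finite abelian group span all `ℂ_p`-valued functions.**
[cite: SerreLinearRepresentations1977, §2.4 and §3.1] [cite: Washington1997, §3] -/
theorem span_range_monoidHom_padicComplex_eq_top :
    Submodule.span ℂ_[p] (Set.range fun χ : G →* ℂ_[p] ↦ (χ : G → ℂ_[p])) = ⊤ := by
  haveI : NeZero (Monoid.exponent G) := ⟨Monoid.exponent_ne_zero_of_finite⟩
  haveI : HasEnoughRootsOfUnity ℂ_[p] (Monoid.exponent G) := hasEnoughRootsOfUnity_padicComplex p _
  exact span_range_monoidHom_eq_top G ℂ_[p]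

/-- The `ℂ_p`-valued annihilator form: a `ℂ_p`-linear map on `G → ℂ_p` killing every character is `0`.
[cite: SerreLinearRepresentations1977, §2.4] [cite: Washington1997, §3] -/
theorem linearMap_padicComplex_eq_zero_of_forall_monoidHom {V : Type*} [AddCommGroup V] [Module ℂ_[p] V]
    (Φ : (G → ℂ_[p]) →ₗ[ℂ_[p]] V) (h : ∀ χ : G →* ℂ_[p], Φ (χ : G → ℂ_[p]) = 0) : Φ = 0 := by
  haveI : NeZero (Monoid.exponent G) := ⟨Monoid.exponent_ne_zero_of_finite⟩
  haveI : HasEnoughRootsOfUnity ℂ_[p] (Monoid.exponent G) := hasEnoughRootsOfUnity_padicComplex p _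
  exact linearMap_eq_zero_of_forall_monoidHom G ℂ_[p] Φ h

/-- Every `ℂ_p`-valued function on a finite abelian group is a finite combination of characters.
[cite: SerreLinearRepresentations1977, §2.4] -/
theorem exists_sum_smul_monoidHom_padicComplex_eq [Fintype (G →* ℂ_[p])] (f : G → ℂ_[p]) :
    ∃ c : (G →* ℂ_[p]) → ℂ_[p], ∑ χ : G →* ℂ_[p], c χ • (χ : G → ℂ_[p]) = f := by
  haveI : NeZero (Monoid.exponent G) := ⟨Monoid.exponent_ne_zero_of_finite⟩
  haveI : HasEnoughRootsOfUnity ℂ_[p] (Monoid.exponent G) := hasEnoughRootsOfUnity_padicComplex p _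
  exact exists_sum_smul_monoidHom_eq G ℂ_[p] f

end CharacterSpan

end Literature.GroupTheory.Abelian

end
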